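import Summits.Ventures.LatticeQCDFlow.Scaling.TaggedHubLumping
import Summits.Ventures.LatticeQCDFlow.Scaling.FiniteOddsPersistenceForm

/-!
HONEST FRAMING: exact (Metropolis-corrected) sampling algorithms for lattice gauge theory; figures
of merit are autocorrelation/cost numbers at stated couplings and volumes; no continuum-physics
claim.

# AdjacentPairPersistence — FOR AN ADJACENT EQUAL-HUB PAIR (`N_X = N_C + δ_a`, `N_Y = N_C + δ_b`, COMMON ORDINARY HUB `z`) THE SHARP PERSISTENCE INEQUALITY OF CHAPTER W
# `cost(ũ_X) + cost(ũ_Y) ≤ G(ũ_X,ũ_Y)·(2K + M_X + M_Y)` AT EVERY SWAP ODDS FOLLOWS FROM TWO COMPARISON STATEMENTS ABOUT THE TAGGED CHAINS — DOMINATION (D) AND THE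
# ★-OCCUPATION COMPARISON (S2) — THE REST BEING THE ★-CERTIFICATE OF FILE 14 (lean-2 GEN-37, ours)

Venture-side (OURS).  Cell `lqcd-flow` (pub-lqcd), unit `pub-lqcd-lean-2-g37`, 2026-08-29.  Chapter W (item 1 (i) at finite swap odds), file 16 = files 14–15 assembled on one adjacent pair.
Setting: contents `S`, `W > 0`, `pW ≤ 1`, `θ = 1/(1+pW)`, `acc(h,v) = min{1,W_h/W_v}`; ordinary composition `N_C` (`Σ N_C = K ≥ 1`), two copies `N_X = N_C + δ_a`, `N_Y = N_C + δ_b`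
(`a ≠ b`) with a common ordinary hub `z` (`N_C(z) ≥ 1`); the tagged hub chains `P_X` (tag `a`), `P_Y` (tag `b`) of file 14 and their tail resolvents `x̃`, `ỹ` from `z` at odds
`σ ∈ [0,1)`; the content hub chains `K_{N_X}`, `K_{N_Y}` of chapter W file 4 and their tail laws `ũ_X`, `ũ_Y` (the end-hub tail laws of chapter W file 7), which by file 15 are the
push-forwards of `x̃`, `ỹ`.  HYPOTHESES (MEMO-gen37's conjectures, numerically without exception; `X` = the copy holding the MORE persistent extra particle, `W_a ≥ W_b`):
**(D)** `ỹ(w) ≤ x̃(w)` for every ordinary content `w` (domination of the ordinary occupations); **(S2)** `(1−θ_b)·ỹ(★) ≤ (1+θ_b−2θ_a)·x̃(★)`.  CONCLUSION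
(`adjacent_cost_le_gain`): with `cost(u) = Σ_w u(w)(1−θ_w)` (`= p·E_u[Wθ]`), `M = Σ_vθ_vN(v)` and `G` the gain of chapter V file 2,
**`cost(ũ_X) + cost(ũ_Y) ≤ x̃(★)·(2K + M_X + M_Y) ≤ G(ũ_X,ũ_Y)·(2K + M_X + M_Y)`** — the sharp persistence inequality of MEMO-gen36 (Conjecture W, `c = 2K+2`) for this pair:
PROOF = file 14's ★-certificate for `X` (`(K+M_X)x̃(★) ≥ cost_X`), (D) (`cost_Y ≤ cost_X − x̃(★)(1−θ_a) + ỹ(★)(1−θ_b)`), (S2), and file 15 (`G = x̃(★) + x̃(a) − ỹ(a) ≥ x̃(★)` under (D)).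
`adjacent_persistence_criterion` rewrites it in the form consumed by chapter W files 6∕7∕11 (`ρΦ ≤ σ[G(Φ+e−2) + p(2E_{μ_0}Wθ − E_{ũ_X}Wθ − E_{ũ_Y}Wθ)]` whenever
`Φ + e − 2 ≥ 2K + M_X + M_Y` and `ρΦ ≤ 2σ(1−θ̄)`).  Hypothesis-equations, no definitions.

## What is proved

* `comp_tag_mass` (`M_{N_C+δ_s} = M_C + θ_s`), `cost_dominated` ((D) ⇒ ordinary cost of `Y` ≤ that of `X`), **`adjacent_cost_le_tag`**, **`adjacent_cost_le_gain`**,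
  **`adjacent_persistence_criterion`**.

Reading (no numerics implied): the adjacent-pair case of Conjecture W reduced to (D) + (S2); with the path-coupling reduction (next files) the law of item 1 (i) at every swap
rate follows from (D) + (S2).  NOT CLAIMED: (D), (S2).  Literature grade (cell rule): OWN, elementary; nothing cited as a fact; no new bib keys.
-/

open Finset

namespace Summit.Ventures.LatticeQCDFlow.Scaling

section AdjacentPersist
variable {S : Type*} [Fintype S] [DecidableEq S]
variable {W θ μ0 : S → ℝ} {acc : S → S → ℝ} {p σ : ℝ} {K : ℕ} {NC NX NY : S → ℕ} {a b z : S}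
variable {PX PY : Option S → Option S → ℝ} {KX KY : S → S → ℝ} {xt yt : Option S → ℝ} {utX utY : S → ℝ}

omit [Fintype S] [DecidableEq S] in
/-- Helper: `θ ≥ 0`. [ours] -/
theorem theta_nonneg' (hW : ∀ v, 0 < W v) (hp0 : 0 ≤ p) (hp : ∀ v, p * W v ≤ 1) (hθ : ∀ v, θ v = 1 / (1 + p * W v)) (v : S) : 0 ≤ θ v := by
  linarith [(theta_mem hW hp0 hp hθ v).1]

/-- The `θ`-mass of `N_C + δ_s` is `M_C + θ_s`. [ours] -/
theorem comp_tag_mass {N : S → ℕ} {s : S} (hN : N = NC + Pi.single s 1) : ∑ v, θ v * (N v : ℝ) = ∑ v, θ v * (NC v : ℝ) + θ s := by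
  rw [hN]; simp only [Pi.add_apply, Nat.cast_add, mul_add, sum_add_distrib]
  congr 1
  rw [show (∑ v, θ v * ((Pi.single s (1 : ℕ) : S → ℕ) v : ℝ)) = ∑ v, (if v = s then θ s else 0) from
    sum_congr rfl fun v _ => by by_cases hv : v = s <;> simp [hv]]
  simp

omit [DecidableEq S] in
/-- (D) bounds the ordinary cost of `Y` by that of `X` (`1 − θ ≥ 0`). [ours] -/
theorem cost_dominated (hW : ∀ v, 0 < W v) (hp0 : 0 ≤ p) (hp : ∀ v, p * W v ≤ 1) (hθ : ∀ v, θ v = 1 / (1 + p * W v))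
    (hdom : ∀ w, yt (some w) ≤ xt (some w)) : ∑ v, yt (some v) * (1 - θ v) ≤ ∑ v, xt (some v) * (1 - θ v) :=
  sum_le_sum fun v _ => mul_le_mul_of_nonneg_right (hdom v) (by linarith [(theta_mem hW hp0 hp hθ v).2])

/-- **THE TWO COSTS AGAINST THE TAGGED OCCUPATION:** under (D) and (S2), `cost(ũ_X) + cost(ũ_Y) ≤ x̃(★)·(2K + M_X + M_Y)`. [ours] -/
theorem adjacent_cost_le_tag (hW : ∀ v, 0 < W v) (hp0 : 0 ≤ p) (hp : ∀ v, p * W v ≤ 1) (hθ : ∀ v, θ v = 1 / (1 + p * W v))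
    (hacc : ∀ h v, acc h v = min 1 (W h / W v)) (hK : 1 ≤ K) (hNC : ∑ v, NC v = K)
    (hX : NX = NC + Pi.single a 1) (hY : NY = NC + Pi.single b 1) (hz : NC z ≠ 0)
    (hPXoff : ∀ h v, h ≠ v → PX (some h) (some v) = if NC h = 0 then 0 else (NC v : ℝ) / K * acc h v)
    (hPXin : ∀ h, PX (some h) none = if NC h = 0 then 0 else acc h a / K)
    (hPXdiag : ∀ h, PX (some h) (some h) = 1 - (∑ v ∈ univ.erase h, PX (some h) (some v) + PX (some h) none))
    (hPXout : ∀ v, PX none (some v) = (NC v : ℝ) / K * acc a v) (hPXstay : PX none none = 1 - ∑ v, PX none (some v))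
    (hPYoff : ∀ h v, h ≠ v → PY (some h) (some v) = if NC h = 0 then 0 else (NC v : ℝ) / K * acc h v)
    (hPYin : ∀ h, PY (some h) none = if NC h = 0 then 0 else acc h b / K)
    (hPYdiag : ∀ h, PY (some h) (some h) = 1 - (∑ v ∈ univ.erase h, PY (some h) (some v) + PY (some h) none))
    (hPYout : ∀ v, PY none (some v) = (NC v : ℝ) / K * acc b v) (hPYstay : PY none none = 1 - ∑ v, PY none (some v))
    (hKXoff : ∀ h v, h ≠ v → KX h v = if NX h = 0 then 0 else (NX v : ℝ) / K * acc h v) (hKXdiag : ∀ h, KX h h = 1 - ∑ v ∈ univ.erase h, KX h v)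
    (hKYoff : ∀ h v, h ≠ v → KY h v = if NY h = 0 then 0 else (NY v : ℝ) / K * acc h v) (hKYdiag : ∀ h, KY h h = 1 - ∑ v ∈ univ.erase h, KY h v)
    (hσ0 : 0 ≤ σ) (hσ1 : σ < 1)
    (hxt : ∀ t, xt t = (1 - σ) * PX (some z) t + σ * ∑ t', xt t' * PX t' t) (hyt : ∀ t, yt t = (1 - σ) * PY (some z) t + σ * ∑ t', yt t' * PY t' t)
    (hutX : ∀ w, utX w = (1 - σ) * KX z w + σ * ∑ h, utX h * KX h w) (hutY : ∀ w, utY w = (1 - σ) * KY z w + σ * ∑ h, utY h * KY h w)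
    (hdom : ∀ w, yt (some w) ≤ xt (some w)) (hS2 : (1 - θ b) * yt none ≤ (1 + θ b - 2 * θ a) * xt none) :
    ∑ w, utX w * (1 - θ w) + ∑ w, utY w * (1 - θ w) ≤ xt none * (2 * K + ∑ v, θ v * (NX v : ℝ) + ∑ v, θ v * (NY v : ℝ)) := by
  classical
  -- push-forwards (file 15)
  have hlX := lump_tail hW hacc hX hPXoff hPXin hPXdiag hPXout hPXstay hKXoff hKXdiag hK hNC hσ0 hσ1 hz hxt hutX
  have hlY := lump_tail hW hacc hY hPYoff hPYin hPYdiag hPYout hPYstay hKYoff hKYdiag hK hNC hσ0 hσ1 hz hyt hutY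
  rw [lump_cost (θ := θ) hlX, lump_cost (θ := θ) hlY, comp_tag_mass (θ := θ) hX, comp_tag_mass (θ := θ) hY]
  -- file 14's certificate for `X`
  have hTX := tagged_certificate_tail' hW hp0 hp hθ hacc hPXoff hPXin hPXdiag hPXout hPXstay hK hNC (M := ∑ v, θ v * (NC v : ℝ) + θ a) rfl hσ0 hσ1 hz hxt
  -- (D) on the ordinary costs
  have hD := cost_dominated hW hp0 hp hθ (xt := xt) (yt := yt) hdom
  -- signs
  have hθa := theta_mem hW hp0 hp hθ a
  have hxt0 : 0 ≤ xt none := by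
    have hP0 := tagged_nonneg hW hacc hPXoff hPXin hPXdiag hPXout hPXstay hK hNC
    have hP1 := tagged_rowsum (P := PX) hPXdiag hPXstay
    exact geomResolvent_nonneg hP0 hP1 hσ0 hσ1 (ν := fun t => PX (some z) t) (fun t => hP0 _ _) hxt none
  have hslack : 0 ≤ (1 - σ) * (1 - θ a) * xt none := mul_nonneg (mul_nonneg (by linarith) (by linarith [hθa.2])) hxt0
  nlinarith [hTX, hD, hS2, hslack]

/-- **THE SHARP PERSISTENCE INEQUALITY FOR AN ADJACENT PAIR FROM (D) + (S2):** `cost(ũ_X) + cost(ũ_Y) ≤ G(ũ_X,ũ_Y)·(2K + M_X + M_Y)`, `G` the gain of chapter V file 2 in the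
form `ũ_X(A) − ũ_Y(A) − Σ_C(ũ_Y − ũ_X)⁺`. [ours] -/
theorem adjacent_cost_le_gain (hW : ∀ v, 0 < W v) (hp0 : 0 ≤ p) (hp : ∀ v, p * W v ≤ 1) (hθ : ∀ v, θ v = 1 / (1 + p * W v))
    (hacc : ∀ h v, acc h v = min 1 (W h / W v)) (hK : 1 ≤ K) (hNC : ∑ v, NC v = K) (hab : a ≠ b)
    (hX : NX = NC + Pi.single a 1) (hY : NY = NC + Pi.single b 1) (hz : NC z ≠ 0)
    (hPXoff : ∀ h v, h ≠ v → PX (some h) (some v) = if NC h = 0 then 0 else (NC v : ℝ) / K * acc h v)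
    (hPXin : ∀ h, PX (some h) none = if NC h = 0 then 0 else acc h a / K)
    (hPXdiag : ∀ h, PX (some h) (some h) = 1 - (∑ v ∈ univ.erase h, PX (some h) (some v) + PX (some h) none))
    (hPXout : ∀ v, PX none (some v) = (NC v : ℝ) / K * acc a v) (hPXstay : PX none none = 1 - ∑ v, PX none (some v))
    (hPYoff : ∀ h v, h ≠ v → PY (some h) (some v) = if NC h = 0 then 0 else (NC v : ℝ) / K * acc h v)
    (hPYin : ∀ h, PY (some h) none = if NC h = 0 then 0 else acc h b / K)
    (hPYdiag : ∀ h, PY (some h) (some h) = 1 - (∑ v ∈ univ.erase h, PY (some h) (some v) + PY (some h) none))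
    (hPYout : ∀ v, PY none (some v) = (NC v : ℝ) / K * acc b v) (hPYstay : PY none none = 1 - ∑ v, PY none (some v))
    (hKXoff : ∀ h v, h ≠ v → KX h v = if NX h = 0 then 0 else (NX v : ℝ) / K * acc h v) (hKXdiag : ∀ h, KX h h = 1 - ∑ v ∈ univ.erase h, KX h v)
    (hKYoff : ∀ h v, h ≠ v → KY h v = if NY h = 0 then 0 else (NY v : ℝ) / K * acc h v) (hKYdiag : ∀ h, KY h h = 1 - ∑ v ∈ univ.erase h, KY h v)
    (hσ0 : 0 ≤ σ) (hσ1 : σ < 1)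
    (hxt : ∀ t, xt t = (1 - σ) * PX (some z) t + σ * ∑ t', xt t' * PX t' t) (hyt : ∀ t, yt t = (1 - σ) * PY (some z) t + σ * ∑ t', yt t' * PY t' t)
    (hutX : ∀ w, utX w = (1 - σ) * KX z w + σ * ∑ h, utX h * KX h w) (hutY : ∀ w, utY w = (1 - σ) * KY z w + σ * ∑ h, utY h * KY h w)
    (hdom : ∀ w, yt (some w) ≤ xt (some w)) (hS2 : (1 - θ b) * yt none ≤ (1 + θ b - 2 * θ a) * xt none) :
    ∑ w, utX w * (1 - θ w) + ∑ w, utY w * (1 - θ w)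
      ≤ (∑ w, utX w * (if NY w < NX w then (1 : ℝ) else 0) - ∑ w, utY w * (if NY w < NX w then (1 : ℝ) else 0)
            - ∑ w, max (utY w - utX w) 0 * (if NX w = NY w then (1 : ℝ) else 0))
          * (2 * K + ∑ v, θ v * (NX v : ℝ) + ∑ v, θ v * (NY v : ℝ)) := by
  classical
  have h1 := adjacent_cost_le_tag hW hp0 hp hθ hacc hK hNC hX hY hz hPXoff hPXin hPXdiag hPXout hPXstay hPYoff hPYin hPYdiag hPYout hPYstay
    hKXoff hKXdiag hKYoff hKYdiag hσ0 hσ1 hxt hyt hutX hutY hdom hS2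
  have hlX := lump_tail hW hacc hX hPXoff hPXin hPXdiag hPXout hPXstay hKXoff hKXdiag hK hNC hσ0 hσ1 hz hxt hutX
  have hlY := lump_tail hW hacc hY hPYoff hPYin hPYdiag hPYout hPYstay hKYoff hKYdiag hK hNC hσ0 hσ1 hz hyt hutY
  have hG := adjacent_gain_ge_of_domination hX hY hab hlX hlY (fun w _ _ => hdom w) (hdom a)
  have hθ0 := theta_nonneg' hW hp0 hp hθ
  have hL : 0 ≤ 2 * (K : ℝ) + ∑ v, θ v * (NX v : ℝ) + ∑ v, θ v * (NY v : ℝ) := by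
    have h2 : 0 ≤ ∑ v, θ v * (NX v : ℝ) := sum_nonneg fun v _ => mul_nonneg (hθ0 v) (Nat.cast_nonneg _)
    have h3 : 0 ≤ ∑ v, θ v * (NY v : ℝ) := sum_nonneg fun v _ => mul_nonneg (hθ0 v) (Nat.cast_nonneg _)
    positivity
  exact h1.trans (mul_le_mul_of_nonneg_right hG hL)

omit [DecidableEq S] in
/-- **… IN THE FORM CONSUMED BY CHAPTER W FILES 6∕7∕11:** if `cost(ũ_X) + cost(ũ_Y) ≤ G·L` with `L ≤ Φ + e − 2`, `G ≥ 0`, and `ρΦ ≤ 2σ·p·E_{μ_0}[Wθ]` (`= 2σ(1−θ̄)`), then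
`ρ·Φ ≤ σ·[G(Φ + e − 2) + p(2E_{μ_0}Wθ − E_{ũ_X}Wθ − E_{ũ_Y}Wθ)]` (`Δ = 1`). [ours] -/
theorem adjacent_persistence_criterion (hW : ∀ v, 0 < W v) (hp0 : 0 ≤ p) (hθ : ∀ v, θ v = 1 / (1 + p * W v)) (hσ0 : 0 ≤ σ)
    {G L Φ e ρ : ℝ} (hG0 : 0 ≤ G) (hcost : ∑ w, utX w * (1 - θ w) + ∑ w, utY w * (1 - θ w) ≤ G * L) (hL : L ≤ Φ + e - 2)
    (hρ : ρ * Φ ≤ 2 * σ * (p * ∑ v, μ0 v * (W v * θ v))) :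
    ρ * 1 * Φ ≤ σ * (G * (Φ + e - 2) + p * 1 * (2 * ∑ v, μ0 v * (W v * θ v) - ∑ w, utX w * (W w * θ w) - ∑ w, utY w * (W w * θ w))) := by
  have hcX : ∑ w, utX w * (1 - θ w) = p * ∑ w, utX w * (W w * θ w) := by
    rw [mul_sum]; exact sum_congr rfl fun w _ => by rw [persist_one_sub_theta hW hp0 hθ w]; ring
  have hcY : ∑ w, utY w * (1 - θ w) = p * ∑ w, utY w * (W w * θ w) := by
    rw [mul_sum]; exact sum_congr rfl fun w _ => by rw [persist_one_sub_theta hW hp0 hθ w]; ring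
  rw [hcX, hcY] at hcost
  have hGL : G * L ≤ G * (Φ + e - 2) := mul_le_mul_of_nonneg_left hL hG0
  nlinarith [mul_le_mul_of_nonneg_left (le_trans hcost hGL) hσ0]

end AdjacentPersist

end Summit.Ventures.LatticeQCDFlow.Scaling
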